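import Summits.QuantumFields.YangMills.Theorems.AlphaInputsT3ACv4ChiInt
import Summits.QuantumFields.YangMills.Theorems.AlphaInputsT3ACv2RecWindow
import Literature.MathematicalPhysics.QuantumFieldTheory.Balaban1983to89.B12GaugeOrbits021
import HarnessLib

/-!
# `AlphaInputsT3ACWindowInChiMinOfRows` — THE (4)-WINDOW LIES IN PRINT'S MINIMISER WINDOW AT CONSTANT `max B₃ 1`, OVER THE ROWS RECORD
# (cell `ym3-torus`, ★★OWNER g35's (α)-row LOCATE sweep 2026-08-30, row #23 `fibre57LowOn` residue `hdom`; seat `ym3-torus-px20` g13, width copy of p1;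
# `--supports stmt-QuantumFields-19936 --as helper`; count-neutral)

WHAT.  `PinnedStep.chiMinAC 𝔎 X c k` (`…AlphaInputsT3ACv3StepLow`) is print's `χ_k` of [Balaban1985UV3] (47) p.267 as a set of level-`k` fields with the window
constant DISPLAYED: «the characteristic function χ_k corresponds to the restrictions on V given by the conditions |U_k(∂p) − 1| < g_kp(g_k)η², p ⊂ T_η»
(print: `c = 1`).  Its docstring says «the constant is displayed so that a socket may enlarge the window (e.g. `c = max B₃ 1`, which puts the (4)-window inside
by [Balaban1985Variational] Thm 1 (8))».  This file is the kernel certificate of that sentence over the VERSION-AGNOSTIC rows record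
`AlphaInputsT3AC.PkgCoreRows F 𝔠 γ hγ hγ1 K` (owner RULING g26-№14 (F-2b); fed by the v3 core and by the v4 χ-package): under the [Balaban1985Variational]
data-smallness threshold `θBal ≤ a₁` (the same letter as ✓`PkgCoreRows.intWindowT3_subset_loPrintAC`),
* §1 `window_subset_chiMinAC_of_rows` — at every level `j ≤ K` the FULL (4)-window `{V | |V(∂p) − 1| < ε₁(j)}` lies in `chiMinAC 𝔠.lane q.X (max 𝔠.B₃ 1) j`:
  row r1 (`q.minRows.1`) at the full radius `ε₁ := θBal(K − j)`, `ε₀ := B₃ε₁` puts the trivial-history minimiser in the space (8) `𝔘(B₃ε₁)`, i.e.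
  `|U_j(V)(∂p) − 1| < B₃·ε₁(j)·L^{−2j} ≤ max(B₃,1)·ε₁(j)·L^{−2j}` (`j = 0`: `U_0 = id`, `1 ≤ max B₃ 1`); hence `{(4)-window} ∩ chiMinAC (max B₃ 1) = {(4)-window}`
  (`window_inter_chiMinAC_eq_window_of_rows`);
* §2 `hdom_of_rows` — the `hdom` letter of the lower-row pins road (✓`PinnedStepTrivPins.fibre57LowOnAC_T3_of_le_gamma` ∕ `…_of_blockAvgChart` ∕
  ✓`AlphaInputsT3ACv3StepLowTrivPins.fibre57LowOnAC_of_pins`: «`chiB … (eps1Of) j (Hist.triv (j+1)) U ≠ 0 → U ∈ lo j`») DISCHARGED for the family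
  `lo j := {(4)-window j} ∩ chiMinAC 𝔠.lane q.X (max 𝔠.B₃ 1) j` from the rows record alone (`Ω_{j+1}(triv) = T`: ✓`plaqSmall_of_chiB_triv_ne_zero` + §1).
* §3 (v1.1) `hlom_of_rows` ∕ `hloinv_of_rows` ∕ `validityFamilyLetters_of_rows` — at the same family the two other validity-family letters of the pins road, `hlom`
  (measurability) and `hloinv` (gauge invariance), are theorems too: by §1 the family IS the (4)-window, which is measurable (✓`T3UnitScaleTilt.measurableSet_plaqSmall`)
  and gauge invariant (✓`B12GaugeOrbits021.plaqSmall_gaugeAct_iff'`, `dist1 (h g h⁻¹) = dist1 g`) — so at `c = max B₃ 1` ALL THREE letters `hlom ∧ hloinv ∧ hdom` come from the rows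
  record; what the lower row still displays there is B0's pins + `hinv` + `hpos`.

WHY (LOCATE, 19936 evidence #52 of this seat): at print's constant `c = 1` (`PinnedStep.loPrintAC = {(4)-window} ∩ chiMinAC 1`, the family the registered χ-row
`StepDataV3ChiAC.fibre57LowOn` reads) the same `hdom` letter asks for «constant-1 regularity of every (4)-small field's minimiser», which [Balaban1985Variational]
Thm 1 (8) does not print (constant `B₃`; `4 < B₃` in EX's text); only the INTERIOR edition (radius `θ∕max(B₃,1)`, constant 1) is a theorem
(✓`intWindowT3_subset_loPrintAC`).  Nothing about `c = 1` is claimed here either way.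

HONEST SCOPE.  [folklore] bookkeeping of row r1; def-free; nothing of [Balaban1985UV3] (47)∕(57), of row #23 `fibre57LowOn`, of the (α) data rows (0∕23), of (O‴χₛ),
`HistoryTailL` (19936), EX, LOWB∘ or `YM3TorusSU2` is proved (rung R3 = SU(2) YM₃ on T³, a RECORD rung: NOT d = 4, NOT infinite volume, NOT a mass gap, NOT Clay;
the Yang–Mills mass gap is NOT proved).  L-floor: none beyond the family's.
References: T. Bałaban, Commun. Math. Phys. **102** (1985) 255–275 [Balaban1985UV3] ((4) p.256, (7) p.257, (47) p.267, (49) p.268); Commun. Math. Phys. **102**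
(1985) 277–309 [Balaban1985Variational] (Thm 1 (6)–(8) pp.278–279).
-/

set_option autoImplicit false

noncomputable section

namespace Summit.QuantumFields.YangMills.Theorems

open MeasureTheory
open Literature.MathematicalPhysics.QuantumFieldTheory.Balaban1983to89
open Literature.MathematicalPhysics.QuantumFieldTheory.Balaban1983to89.T3ContinuumYM3Torus
open Literature.MathematicalPhysics.QuantumFieldTheory.Balaban1983to89.T3UnitScaleTilt (θBal)
open Literature.MathematicalPhysics.QuantumFieldTheory.Balaban1983to89.T3LevelShift (fieldShift)
open Literature.MathematicalPhysics.QuantumFieldTheory.Balaban1983to89.T3PrintedRegularMinimiser (regFibrePr)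
open Literature.MathematicalPhysics.QuantumFieldTheory.Balaban1983to89.T3RegularMinimiser (regThreshold)
open Literature.MathematicalPhysics.QuantumFieldTheory.Balaban1985CMP102
open Literature.MathematicalPhysics.QuantumFieldTheory.Balaban1985CMP102.Setting
open Summit.QuantumFields.Balaban3D.Carriers
open Summit.QuantumFields.Balaban3D.Proofs.Primitives
open Summit.QuantumFields.Balaban3D.Proofs.TowerAC
open Summit.QuantumFields.Balaban3D.Proofs.StandardAC
open Summit.QuantumFields.Balaban3D.Proofs.InputsAC
open Summit.QuantumFields.Balaban3D.Proofs.Bound55Masses (chiB)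
open Literature.MathematicalPhysics.QuantumFieldTheory.Balaban1983to89.GaugeField (gaugeAct)

variable {F : T3Family} {𝔠 : AlphaConsts F.L (suGroupModel 2).N} {γ : ℝ} {hγ : 0 < γ} {hγ1 : γ ≤ (min 𝔠.gamma0 1) ^ 2} {K : ℕ}

namespace AlphaInputsT3AC.PkgCoreRows

variable (q : AlphaInputsT3AC.PkgCoreRows F 𝔠 γ hγ hγ1 K)

/-! ## §1 The (4)-window lies in `chiMinAC (max B₃ 1)` — row r1 at the full radius -/

/-- Auxiliary form at the levels `K − n`, `n < K` (at least one averaging step): every field of the (4)-window `|V(∂p) − 1| < ε₁(K−n) = θBal(n)` has its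
trivial-history minimiser `U_{K−n}(V)` in [Balaban1985Variational]'s space (8) `𝔘(B₃θBal(n))` (row r1 = `q.minRows.1` at `ε₁ := θBal(n)`, `ε₀ := B₃ε₁`, legal since
`θBal(n) ≤ a₁` and `B₃a₁ ≤ a₀`), hence `V ∈ chiMinAC 𝔠.lane q.X (max 𝔠.B₃ 1) (K − n)`. [cite: Balaban1985Variational, Thm 1 (8) p.279] -/
theorem window_subset_chiMinAC_of_rows_aux (ha₁ : ∀ i, θBal F.L γ 𝔠.b₀ 𝔠.p₀ i ≤ q.a₁) (n : ℕ) (hnK : n < K) :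
    {V : GaugeField (F.P K) (K - n) (Matrix.specialUnitaryGroup (Fin 2) ℂ) |
        PlaqSmall (eps1Of (T3Scales F γ hγ (hγ1.trans (sq_min_one_le _ 𝔠.gamma0_pos)) K) 𝔠.lane.carrier (K - n)) V} ⊆
      PinnedStep.chiMinAC 𝔠.lane q.X (max 𝔠.B₃ 1) (K - n) := by
  have hBle : 𝔠.B₃ ≤ max 𝔠.B₃ 1 := le_max_left _ _
  have hnn : K - (K - n) = n := Nat.sub_sub_self hnK.le
  have hθ : 0 < θBal F.L γ 𝔠.b₀ 𝔠.p₀ n := by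
    have := q.θBal_pos (K - n) (Nat.sub_le _ _); rwa [hnn] at this
  have heps : eps1Of (T3Scales F γ hγ (hγ1.trans (sq_min_one_le _ 𝔠.gamma0_pos)) K) 𝔠.lane.carrier (K - n) = θBal F.L γ 𝔠.b₀ 𝔠.p₀ n := by
    have := q.eps1_eq (K - n) (Nat.sub_le _ _); rwa [hnn] at this
  -- the letters of row r1 at the FULL radius `ε₁ := θ`, `ε₀ := B₃θ`
  have hθa : θBal F.L γ 𝔠.b₀ 𝔠.p₀ n ≤ q.a₁ := ha₁ n
  have hhi : 𝔠.B₃ * θBal F.L γ 𝔠.b₀ 𝔠.p₀ n ≤ q.a₀ :=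
    (mul_le_mul_of_nonneg_left hθa 𝔠.B₃_pos.le).trans q.consts_ok.2.2
  intro V hV
  rw [Set.mem_setOf_eq, heps] at hV
  change PlaqSmall (max 𝔠.B₃ 1 * eps1Of (T3Scales F γ hγ (hγ1.trans (sq_min_one_le _ 𝔠.gamma0_pos)) K) 𝔠.lane.carrier (K - n) *
      ((F.L : ℝ)⁻¹) ^ (2 * (K - n))) (ukAll q.X.Uk (K - n) V)
  rw [heps, ← q.X.UkH_triv (K - n) V]
  -- shift the datum to height `n`, level `0`, apply row r1, shift back
  let hsh := F.sitesPerDir_eq (m := F.m) (K := K) (j := K - n) (m' := F.m) (K' := n) (j' := 0) (by omega)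
  have hV₀ : PlaqSmall (θBal F.L γ 𝔠.b₀ 𝔠.p₀ n) (fieldShift hsh.symm V) :=
    (T3CruxEstimates.plaqSmall_fieldShift F hsh.symm _ V).mpr hV
  have hr1 := (q.minRows.1 n hnK (θBal F.L γ 𝔠.b₀ 𝔠.p₀ n) (𝔠.B₃ * θBal F.L γ 𝔠.b₀ 𝔠.p₀ n) hθ hθa le_rfl hhi
    (fieldShift hsh.symm V) hV₀).1
  rw [T3LevelShift.fieldShift_symm_fieldShift] at hr1
  have hreg : PlaqSmall (regThreshold F n K (𝔠.B₃ * θBal F.L γ 𝔠.b₀ 𝔠.p₀ n)) (q.UkH (K - n) (Hist.triv (F.P K) (K - n)) V) :=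
    ((T3PrintedRegularMinimiser.mem_regFibrePr_iff F).mp hr1).2.1
  intro p
  refine (hreg p).trans_le ?_
  show 𝔠.B₃ * θBal F.L γ 𝔠.b₀ 𝔠.p₀ n * ((F.L : ℝ)⁻¹) ^ (2 * (K - n)) ≤
    max 𝔠.B₃ 1 * θBal F.L γ 𝔠.b₀ 𝔠.p₀ n * ((F.L : ℝ)⁻¹) ^ (2 * (K - n))
  exact mul_le_mul_of_nonneg_right (mul_le_mul_of_nonneg_right hBle hθ.le) (pow_nonneg (inv_nonneg.mpr (Nat.cast_nonneg _)) _)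

/-- ★ **THE (4)-WINDOW LIES IN PRINT'S MINIMISER WINDOW AT CONSTANT `max B₃ 1`, every level `j ≤ K`, over the ROWS record** (`j = 0`: `U_0 = id` and `1 ≤ max B₃ 1`;
`j ≥ 1`: row r1 at the full radius), under the [Balaban1985Variational] data-smallness threshold `θBal ≤ a₁` — the sentence of `PinnedStep.chiMinAC`'s docstring
«`c = max B₃ 1` … puts the (4)-window inside by [Balaban1985Variational] Thm 1 (8)» as a theorem. [cite: Balaban1985Variational, Thm 1 (8) p.279; Balaban1985UV3, (47) p.267] -/
theorem window_subset_chiMinAC_of_rows (ha₁ : ∀ i, θBal F.L γ 𝔠.b₀ 𝔠.p₀ i ≤ q.a₁) (j : ℕ) (hj : j ≤ K) :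
    {V : GaugeField (F.P K) j (Matrix.specialUnitaryGroup (Fin 2) ℂ) |
        PlaqSmall (eps1Of (T3Scales F γ hγ (hγ1.trans (sq_min_one_le _ 𝔠.gamma0_pos)) K) 𝔠.lane.carrier j) V} ⊆
      PinnedStep.chiMinAC 𝔠.lane q.X (max 𝔠.B₃ 1) j := by
  rcases Nat.eq_zero_or_pos j with rfl | hj1
  · have hB1 : 1 ≤ max 𝔠.B₃ 1 := le_max_right _ _
    have heps : eps1Of (T3Scales F γ hγ (hγ1.trans (sq_min_one_le _ 𝔠.gamma0_pos)) K) 𝔠.lane.carrier 0 = θBal F.L γ 𝔠.b₀ 𝔠.p₀ (K - 0) :=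
      q.eps1_eq 0 (Nat.zero_le _)
    have hε : 0 ≤ eps1Of (T3Scales F γ hγ (hγ1.trans (sq_min_one_le _ 𝔠.gamma0_pos)) K) 𝔠.lane.carrier 0 := by
      rw [heps]; exact (q.θBal_pos 0 (Nat.zero_le _)).le
    intro V hV
    change PlaqSmall (max 𝔠.B₃ 1 * eps1Of (T3Scales F γ hγ (hγ1.trans (sq_min_one_le _ 𝔠.gamma0_pos)) K) 𝔠.lane.carrier 0 *
        ((F.L : ℝ)⁻¹) ^ (2 * 0)) (ukAll q.X.Uk 0 V)
    intro p
    simp only [mul_zero, pow_zero, mul_one]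
    exact (hV p).trans_le (le_mul_of_one_le_left hε hB1)
  · have h := q.window_subset_chiMinAC_of_rows_aux ha₁ (K - j) (by omega)
    rwa [Nat.sub_sub_self hj] at h

/-- At constant `max B₃ 1` the intersected family `{(4)-window} ∩ chiMinAC` IS the (4)-window, every level `j ≤ K`. [cite: Balaban1985Variational, Thm 1 (8) p.279] -/
theorem window_inter_chiMinAC_eq_window_of_rows (ha₁ : ∀ i, θBal F.L γ 𝔠.b₀ 𝔠.p₀ i ≤ q.a₁) (j : ℕ) (hj : j ≤ K) :
    {V : GaugeField (F.P K) j (Matrix.specialUnitaryGroup (Fin 2) ℂ) |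
        PlaqSmall (eps1Of (T3Scales F γ hγ (hγ1.trans (sq_min_one_le _ 𝔠.gamma0_pos)) K) 𝔠.lane.carrier j) V} ∩
      PinnedStep.chiMinAC 𝔠.lane q.X (max 𝔠.B₃ 1) j =
    {V | PlaqSmall (eps1Of (T3Scales F γ hγ (hγ1.trans (sq_min_one_le _ 𝔠.gamma0_pos)) K) 𝔠.lane.carrier j) V} :=
  Set.inter_eq_left.mpr (q.window_subset_chiMinAC_of_rows ha₁ j hj)

/-- Print's family `loPrintAC` (constant 1) lies in the constant-`max B₃ 1` family (monotonicity of `chiMinAC` in `c`; no rows needed). [cite: Balaban1985UV3, (47) p.267] -/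
theorem loPrintAC_subset_window_inter_chiMinAC (j : ℕ) :
    PinnedStep.loPrintAC 𝔠.lane q.X j ⊆
      {V : GaugeField (F.P K) j (Matrix.specialUnitaryGroup (Fin 2) ℂ) |
          PlaqSmall (eps1Of (T3Scales F γ hγ (hγ1.trans (sq_min_one_le _ 𝔠.gamma0_pos)) K) 𝔠.lane.carrier j) V} ∩
        PinnedStep.chiMinAC 𝔠.lane q.X (max 𝔠.B₃ 1) j := by
  intro V hV
  refine ⟨hV.1, ?_⟩
  have h1 : PlaqSmall (1 * eps1Of (T3Scales F γ hγ (hγ1.trans (sq_min_one_le _ 𝔠.gamma0_pos)) K) 𝔠.lane.carrier j *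
      ((F.L : ℝ)⁻¹) ^ (2 * j)) (ukAll q.X.Uk j V) := hV.2
  change PlaqSmall (max 𝔠.B₃ 1 * eps1Of (T3Scales F γ hγ (hγ1.trans (sq_min_one_le _ 𝔠.gamma0_pos)) K) 𝔠.lane.carrier j *
      ((F.L : ℝ)⁻¹) ^ (2 * j)) (ukAll q.X.Uk j V)
  intro p
  -- the product `ε₁(j)·L^{−2j}` is positive because it dominates a non-negative distance strictly
  have hpos : 0 < eps1Of (T3Scales F γ hγ (hγ1.trans (sq_min_one_le _ 𝔠.gamma0_pos)) K) 𝔠.lane.carrier j * ((F.L : ℝ)⁻¹) ^ (2 * j) := by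
    have := (GaugeGroup.dist1_nonneg _).trans_lt (h1 p); rwa [one_mul] at this
  refine (h1 p).trans_le ?_
  rw [mul_assoc, mul_assoc]
  exact mul_le_mul_of_nonneg_right (le_max_right _ _) hpos.le

/-! ## §2 The `hdom` letter of the lower-row pins road at constant `max B₃ 1` -/

/-- ★★ **`hdom` FROM THE ROWS RECORD at `lo j := {(4)-window j} ∩ chiMinAC (max B₃ 1) j`**: at the trivial new history `Ω_{j+1}(triv) = T` and `P_j = ∅`, so the (49)
small-field factor `chiB … (eps1Of) j (Hist.triv (j+1))` is the characteristic function of ALL level-`j` plaquettes (✓`WindowStep.plaqSmall_of_chiB_triv_ne_zero`);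
a field in its support is (4)-small, hence in the family by §1.  This is the hypothesis `hdom` of ✓`PinnedStepTrivPins.fibre57LowOnAC_T3_of_le_gamma` ∕
✓`…StepLowTrivPins.fibre57LowOnAC_of_pins` read at this family, every `j ≤ K`. [cite: Balaban1985UV3, (47) p.267 + (49) p.268; Balaban1985Variational, Thm 1 (8) p.279] -/
theorem hdom_of_rows (ha₁ : ∀ i, θBal F.L γ 𝔠.b₀ 𝔠.p₀ i ≤ q.a₁) (j : ℕ) (hj : j ≤ K)
    (U : GaugeField (F.P K) j (Matrix.specialUnitaryGroup (Fin 2) ℂ))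
    (h : chiB 𝔠.lane.carrier.M₁ (rcolOf (T3Scales F γ hγ (hγ1.trans (sq_min_one_le _ 𝔠.gamma0_pos)) K) 𝔠.lane.carrier)
      (eps1Of (T3Scales F γ hγ (hγ1.trans (sq_min_one_le _ 𝔠.gamma0_pos)) K) 𝔠.lane.carrier) j (Hist.triv (F.P K) (j + 1)) U ≠ 0) :
    U ∈ {V : GaugeField (F.P K) j (Matrix.specialUnitaryGroup (Fin 2) ℂ) |
          PlaqSmall (eps1Of (T3Scales F γ hγ (hγ1.trans (sq_min_one_le _ 𝔠.gamma0_pos)) K) 𝔠.lane.carrier j) V} ∩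
        PinnedStep.chiMinAC 𝔠.lane q.X (max 𝔠.B₃ 1) j := by
  have hU : PlaqSmall (eps1Of (T3Scales F γ hγ (hγ1.trans (sq_min_one_le _ 𝔠.gamma0_pos)) K) 𝔠.lane.carrier j) U :=
    WindowStep.plaqSmall_of_chiB_triv_ne_zero _ _ _ j U h
  exact ⟨hU, q.window_subset_chiMinAC_of_rows ha₁ j hj hU⟩


/-! ## §3 (v1.1) The other two validity-family letters at constant `max B₃ 1`: measurability and gauge invariance -/

/-- **`hlom` FROM THE ROWS RECORD**: the family `{(4)-window j} ∩ chiMinAC (max B₃ 1) j` is measurable — it IS the (4)-window (§1), a measurable set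
(✓`T3UnitScaleTilt.measurableSet_plaqSmall`).  The hypothesis `hlom` of ✓`PinnedStepTrivPins.fibre57LowOnAC_T3_of_le_gamma` at this family.
[cite: Balaban1985UV3, (4) p.256 + (47) p.267] -/
theorem hlom_of_rows (ha₁ : ∀ i, θBal F.L γ 𝔠.b₀ 𝔠.p₀ i ≤ q.a₁) (j : ℕ) (hj : j ≤ K) :
    MeasurableSet ({V : GaugeField (F.P K) j (Matrix.specialUnitaryGroup (Fin 2) ℂ) |
        PlaqSmall (eps1Of (T3Scales F γ hγ (hγ1.trans (sq_min_one_le _ 𝔠.gamma0_pos)) K) 𝔠.lane.carrier j) V} ∩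
      PinnedStep.chiMinAC 𝔠.lane q.X (max 𝔠.B₃ 1) j) := by
  rw [q.window_inter_chiMinAC_eq_window_of_rows ha₁ j hj]
  exact T3UnitScaleTilt.measurableSet_plaqSmall _

/-- **`hloinv` FROM THE ROWS RECORD**: the family `{(4)-window j} ∩ chiMinAC (max B₃ 1) j` is gauge invariant — it IS the (4)-window (§1), and plaquette
smallness is invariant under `U ↦ U^u` (`U^u(∂p) = u(p₋)U(∂p)u(p₋)⁻¹`, ✓`B12GaugeOrbits021.plaqSmall_gaugeAct_iff'`).  NO covariance of the minimiser map is needed at this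
constant (at print's `c = 1` the same letter asks for the orbit-covariance of [7]'s minimiser).  The hypothesis `hloinv` of ✓`fibre57LowOnAC_T3_of_le_gamma` at this family.
[cite: Balaban1985UV3, (3)–(4) p.256 + (47) p.267; Balaban1987RG1, (0.13) p.254] -/
theorem hloinv_of_rows (ha₁ : ∀ i, θBal F.L γ 𝔠.b₀ 𝔠.p₀ i ≤ q.a₁) (j : ℕ) (hj : j ≤ K)
    (u : GaugeTransf (F.P K) j (Matrix.specialUnitaryGroup (Fin 2) ℂ)) (U : GaugeField (F.P K) j (Matrix.specialUnitaryGroup (Fin 2) ℂ)) :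
    gaugeAct u U ∈ {V : GaugeField (F.P K) j (Matrix.specialUnitaryGroup (Fin 2) ℂ) |
        PlaqSmall (eps1Of (T3Scales F γ hγ (hγ1.trans (sq_min_one_le _ 𝔠.gamma0_pos)) K) 𝔠.lane.carrier j) V} ∩
      PinnedStep.chiMinAC 𝔠.lane q.X (max 𝔠.B₃ 1) j ↔
    U ∈ {V : GaugeField (F.P K) j (Matrix.specialUnitaryGroup (Fin 2) ℂ) |
        PlaqSmall (eps1Of (T3Scales F γ hγ (hγ1.trans (sq_min_one_le _ 𝔠.gamma0_pos)) K) 𝔠.lane.carrier j) V} ∩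
      PinnedStep.chiMinAC 𝔠.lane q.X (max 𝔠.B₃ 1) j := by
  rw [q.window_inter_chiMinAC_eq_window_of_rows ha₁ j hj]
  exact B12GaugeOrbits021.plaqSmall_gaugeAct_iff' _ u U

/-- ★★ **THE THREE VALIDITY-FAMILY LETTERS OF THE LOWER-ROW PINS ROAD AT CONSTANT `max B₃ 1`, FROM THE ROWS RECORD ALONE**: `hlom ∧ hloinv ∧ hdom` for
`lo j := {(4)-window j} ∩ chiMinAC 𝔠.lane q.X (max 𝔠.B₃ 1) j`, every `j ≤ K`, in the shapes ✓`PinnedStepTrivPins.fibre57LowOnAC_T3_of_le_gamma` reads them.  What that theorem still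
displays at this family: the (55)∕(58) pins of `𝔖` (B0), `hinv`, `hpos`. [cite: Balaban1985UV3, (47) p.267 + (49) p.268 + p.272 L32–33; Balaban1985Variational, Thm 1 (8) p.279] -/
theorem validityFamilyLetters_of_rows (ha₁ : ∀ i, θBal F.L γ 𝔠.b₀ 𝔠.p₀ i ≤ q.a₁) (j : ℕ) (hj : j ≤ K) :
    MeasurableSet ({V : GaugeField (F.P K) j (Matrix.specialUnitaryGroup (Fin 2) ℂ) |
          PlaqSmall (eps1Of (T3Scales F γ hγ (hγ1.trans (sq_min_one_le _ 𝔠.gamma0_pos)) K) 𝔠.lane.carrier j) V} ∩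
        PinnedStep.chiMinAC 𝔠.lane q.X (max 𝔠.B₃ 1) j) ∧
      (∀ (u : GaugeTransf (F.P K) j (Matrix.specialUnitaryGroup (Fin 2) ℂ)) (U : GaugeField (F.P K) j (Matrix.specialUnitaryGroup (Fin 2) ℂ)),
        gaugeAct u U ∈ {V : GaugeField (F.P K) j (Matrix.specialUnitaryGroup (Fin 2) ℂ) |
            PlaqSmall (eps1Of (T3Scales F γ hγ (hγ1.trans (sq_min_one_le _ 𝔠.gamma0_pos)) K) 𝔠.lane.carrier j) V} ∩
          PinnedStep.chiMinAC 𝔠.lane q.X (max 𝔠.B₃ 1) j ↔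
        U ∈ {V : GaugeField (F.P K) j (Matrix.specialUnitaryGroup (Fin 2) ℂ) |
            PlaqSmall (eps1Of (T3Scales F γ hγ (hγ1.trans (sq_min_one_le _ 𝔠.gamma0_pos)) K) 𝔠.lane.carrier j) V} ∩
          PinnedStep.chiMinAC 𝔠.lane q.X (max 𝔠.B₃ 1) j) ∧
      (∀ U : GaugeField (F.P K) j (Matrix.specialUnitaryGroup (Fin 2) ℂ),
        chiB 𝔠.lane.carrier.M₁ (rcolOf (T3Scales F γ hγ (hγ1.trans (sq_min_one_le _ 𝔠.gamma0_pos)) K) 𝔠.lane.carrier)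
            (eps1Of (T3Scales F γ hγ (hγ1.trans (sq_min_one_le _ 𝔠.gamma0_pos)) K) 𝔠.lane.carrier) j (Hist.triv (F.P K) (j + 1)) U ≠ 0 →
          U ∈ {V : GaugeField (F.P K) j (Matrix.specialUnitaryGroup (Fin 2) ℂ) |
              PlaqSmall (eps1Of (T3Scales F γ hγ (hγ1.trans (sq_min_one_le _ 𝔠.gamma0_pos)) K) 𝔠.lane.carrier j) V} ∩
            PinnedStep.chiMinAC 𝔠.lane q.X (max 𝔠.B₃ 1) j) :=
  ⟨q.hlom_of_rows ha₁ j hj, q.hloinv_of_rows ha₁ j hj, fun U h => q.hdom_of_rows ha₁ j hj U h⟩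

end AlphaInputsT3AC.PkgCoreRows

end Summit.QuantumFields.YangMills.Theorems

end
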